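import Summits.HodgeConjecture.HodgeConjecture.Theorems.F0P3cStCharTSShellVal    -- ★ p849069 (this seat) D1 «SHELL-VAL»: `valuation_charpoly_coeff_sub_le'`, `valuation_eq_of_sub_lt`
import HarnessLib

/-!
# F0 · P3c · line LH6 «StCharTS» — road (D) «DEEP-FL», brick D3-iii-val «OFF-STRATUM VALUATIONS»: the rank-2 shell pattern, and the passage from the
# valuation pattern of a MATCHED cubic `(X² − c₁X + c₂)(X − u)`, `|u| = 1`, to the hyperbolicity inequality `|c₂| < |c₁|²` of ★ HYP

Cell `pub/hodgecm-mathlib`, crux H413 = `stmt-HodgeConjecture-24833` (`--supports` lane, helper), route HCCMUnconditional; seat LH6-p04 (g2), road (D) «DEEP-FL»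
(owner), interface v2 `F0/P3b/LH6-p04/g2/ROAD-D.interface.v2.txt`, brick D3-iii «OFF-STRATUM VANISHING» — its valuation-theoretic core.  THEOREMS ONLY
(generic: a commutative ring ∕ field with a valuation; Mathlib + ★ D1), sorry-free, no definition ∕ instance ∕ notation ∕ named fact.  HONEST LABEL: HC_CM is
proved only modulo the 7 printed citations (2 remaining: hLiu418 = stmt-HodgeConjecture-24832, h413 = stmt-HodgeConjecture-24833) until rung 0 closes;
count-neutral; elementary valuation algebra.

THE MATHEMATICS (D3-iii of the road: at a `G`-regular `γ_H = (h₂, h₁) ∈ H_v` OFF the Levi stratum both sides of the transfer identity for the shell pair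
`(c_b·𝟙_{K_H b_H K_H}, 𝟙_{K_n b K_n})` vanish).  The `G`-side classes matched with `γ_H` have characteristic polynomial `charpoly(h₂)·(X − u)` with `u = h₁ ∈ U(Φ₁)`,
`|u| = 1` (★ `EndoMatches` ∕ `IsLocalNormPair`: conjugate in `GL₃` to the block-diagonal image); a class meeting the shell `K_n z aᵐ K_n` has the coefficient valuations
`(|z|q^{m}, |z|²q^{m}, |z|³)` (★ D1 `valuation_charpoly_coeff_shell_three`); the `H`-side classes stably conjugate to `γ_H` that meet `K_H b_H K_H` give `charpoly(h₂)` the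
RANK-2 shell pattern directly.  In both cases `|c₂(h₂)| < |c₁(h₂)|²`, so ★ HYP `exists_mem_unitaryGroup_eigenframe_of_valued_det_lt` puts `γ_H` ON the stratum.
* §1 `valuation_charpoly_coeff_shell_two` — D1's exact-valuation statement on `Fin 2`: for `x = k₁·diag(d₀, d₁)·k₂`, `k ≡ 1 (mod r)`, `r < 1`, `v(d₀) < v(d₁)`, `v(d₀) ≠ 0`:
  `v(coeff₁ charpoly x) = v(d₁)`, `v(coeff₀ charpoly x) = v(d₀)·v(d₁)` (from ★ `valuation_charpoly_coeff_sub_le'` at `n = Fin 2`).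
* §2 `valuation_quadratic_of_cubic_pattern` — if `e₁ = c₁ + u`, `e₂ = c₂ + c₁u`, `e₃ = c₂u` (the coefficients of `(X² − c₁X + c₂)(X − u)`) with `v(u) = 1`, `v(e₁) = A`,
  `v(e₃) = B`, `1 < A`: then `v(c₁) = A` and `v(c₂) = B`; hence (`valued_lt_sq_of_cubic_pattern`) `B < A²` as soon as `B ≤ A` — the HYP inequality `|c₂| < |c₁|²`.
* §3 `charpoly_mul_X_sub_C_coeff` — the coefficient dictionary `(X² − c₁X + c₂)(X − u) = X³ − (c₁+u)X² + (c₂ + c₁u)X − c₂u` for `charpoly` of a `2 ⊕ 1` block matrix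
  `fromBlocks h₂ 0 0 (u)` (Mathlib `charpoly_fromBlocks_zero₁₂`, `charpoly_fin_two`), so that §2 applies to `charpoly (blockDiag(h₂, u))` verbatim.

## References
* [Rogawski1990] J. D. Rogawski, *Automorphic Representations of Unitary Groups in Three Variables*, Ann. of Math. Stud. 123 (1990), §4.3 p. 42 (`G`-regular
  `γ_H`, the block embedding), §3.6 p. 31, §12.7 L. 12.7.3 (proof) p. 195.
* [Casselman1995] W. Casselman, *Introduction to the theory of admissible representations of p-adic reductive groups* (1995), Prop. 1.4.4, §1.5.
-/

set_option autoImplicit false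
-- the mandated namespace has the single-problem summit's repeated segment (`HodgeConjecture.HodgeConjecture`)
set_option linter.dupNamespace false

open Matrix Polynomial
open scoped BigOperators

namespace Summit.HodgeConjecture.HodgeConjecture.Cruxes.H413.F0P3cStCharTSOffStratumVal

/-! ## §1 The rank-2 shell pattern -/

section Ring

variable {R : Type*} [CommRing R] {Γ₀ : Type*} [LinearOrderedCommGroupWithZero Γ₀] (v : Valuation R Γ₀)

/-- The coefficients of `charpoly (diag d)` on `Fin 2`: `X² − (d₀ + d₁)X + d₀d₁`. [folklore] -/
theorem charpoly_diagonal_fin_two_coeff (d : Fin 2 → R) :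
    (Matrix.diagonal d).charpoly.coeff 1 = -(d 0 + d 1) ∧ (Matrix.diagonal d).charpoly.coeff 0 = d 0 * d 1 := by
  have h : (Matrix.diagonal d).charpoly = (X - C (d 0)) * (X - C (d 1)) := by
    rw [Matrix.charpoly_diagonal, Fin.prod_univ_two]
  have h' : (X - C (d 0)) * (X - C (d 1)) = X ^ 2 - C (d 0 + d 1) * X + C (d 0 * d 1) := by
    simp only [map_add, map_mul]
    ring
  rw [h, h']
  simp only [coeff_sub, coeff_add, coeff_C_mul, coeff_X_pow, coeff_X, coeff_C]
  norm_num

/-- **EXACT VALUATIONS ON THE RANK-2 SHELL** (★ D1 at `n = Fin 2`): for `x = k₁·diag(d₀, d₁)·k₂` with `k₁, k₂ ≡ 1 (mod r)`, `r < 1`, `v(d₀) < v(d₁)`, `v(d₀) ≠ 0`: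
`v(coeff₁ charpoly x) = v(d₁)` and `v(coeff₀ charpoly x) = v(d₀)·v(d₁)` — the pattern of the `U(Φ₂)`-shell `K₂ z₂ a₂ᵐ K₂`, `a₂ = diag(α, (σα)⁻¹)`.
[cite: Casselman1995, Prop. 1.4.4, §1.5] [cite: Rogawski1990, §12.7 L. 12.7.3 (proof) p. 195] -/
theorem valuation_charpoly_coeff_shell_two (d : Fin 2 → R) (k₁ k₂ : Matrix (Fin 2) (Fin 2) R) {r : Γ₀} (hr : r < 1)
    (hk₁ : ∀ i j, v (k₁ i j - (1 : Matrix (Fin 2) (Fin 2) R) i j) ≤ r) (hk₂ : ∀ i j, v (k₂ i j - (1 : Matrix (Fin 2) (Fin 2) R) i j) ≤ r)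
    (h0 : v (d 0) ≠ 0) (h01 : v (d 0) < v (d 1)) :
    v ((k₁ * Matrix.diagonal d * k₂).charpoly.coeff 1) = v (d 1) ∧
      v ((k₁ * Matrix.diagonal d * k₂).charpoly.coeff 0) = v (d 0) * v (d 1) := by
  obtain ⟨hc1, hc0⟩ := charpoly_diagonal_fin_two_coeff d
  have h1 : v (d 1) ≠ 0 := ne_of_gt (lt_of_le_of_lt zero_le h01)
  have he1 : v (d 0 + d 1) = v (d 1) := Valuation.map_add_eq_of_lt_right v h01
  have hM1 : ∀ s ∈ (Finset.univ : Finset (Fin 2)).powersetCard 1, ∏ i ∈ s, v (d i) ≤ v (d 1) := by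
    intro s hs
    obtain ⟨a, rfl⟩ := Finset.card_eq_one.1 (Finset.mem_powersetCard.1 hs).2
    rw [Finset.prod_singleton]
    fin_cases a
    · exact h01.le
    · exact le_rfl
  have hM2 : ∀ s ∈ (Finset.univ : Finset (Fin 2)).powersetCard 2, ∏ i ∈ s, v (d i) ≤ v (d 0) * v (d 1) := by
    intro s hs
    have hs2 : s = Finset.univ := Finset.eq_univ_of_card s (by rw [(Finset.mem_powersetCard.1 hs).2, Fintype.card_fin])
    subst hs2
    rw [Fin.prod_univ_two]
  have hr1 : r ≤ 1 := hr.le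
  have e1 := F0P3cStCharTSShellVal.valuation_charpoly_coeff_sub_le' v d k₁ k₂ hr1 hk₁ hk₂ (j := 1) (by rw [Fintype.card_fin]; norm_num) hM1
  have e2 := F0P3cStCharTSShellVal.valuation_charpoly_coeff_sub_le' v d k₁ k₂ hr1 hk₁ hk₂ (j := 2) (by rw [Fintype.card_fin]) hM2
  simp only [Fintype.card_fin, show 2 - 1 = 1 from rfl, Nat.sub_self] at e1 e2
  rw [hc1] at e1
  rw [hc0] at e2
  have hv1 : v (-(d 0 + d 1)) = v (d 1) := by rw [Valuation.map_neg, he1]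
  have hv0 : v (d 0 * d 1) = v (d 0) * v (d 1) := Valuation.map_mul v _ _
  refine ⟨?_, ?_⟩
  · rw [← hv1]
    refine F0P3cStCharTSShellVal.valuation_eq_of_sub_lt v (lt_of_le_of_lt e1 ?_)
    rw [hv1]
    calc r * v (d 1) < 1 * v (d 1) := mul_lt_mul_of_pos_right hr (zero_lt_iff.2 h1)
      _ = v (d 1) := one_mul _
  · rw [← hv0]
    refine F0P3cStCharTSShellVal.valuation_eq_of_sub_lt v (lt_of_le_of_lt e2 ?_)
    rw [hv0]
    calc r * (v (d 0) * v (d 1)) < 1 * (v (d 0) * v (d 1)) := mul_lt_mul_of_pos_right hr (zero_lt_iff.2 (mul_ne_zero h0 h1))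
      _ = v (d 0) * v (d 1) := one_mul _

/-! ## §2 From the cubic pattern of a matched class to the hyperbolicity inequality of the `U(Φ₂)`-block -/

/-- **The quadratic factor inherits the shell pattern.**  If `v(u) = 1`, `v(c₁ + u) = A` with `1 < A`, and `v(c₂ u) = B`, then `v(c₁) = A` and `v(c₂) = B` — the
coefficients `e₁ = c₁ + u`, `e₃ = c₂u` of `(X² − c₁X + c₂)(X − u)` determine those of the quadratic factor when the linear factor is a unit and `e₁` is large.
[cite: Rogawski1990, §4.3 p. 42; §12.7 p. 195] -/
theorem valuation_quadratic_of_cubic_pattern {c₁ c₂ u : R} {A B : Γ₀} (hu : v u = 1) (he₁ : v (c₁ + u) = A) (hA : 1 < A) (he₃ : v (c₂ * u) = B) :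
    v c₁ = A ∧ v c₂ = B := by
  constructor
  · -- if `v c₁ ≤ 1` then `v(c₁ + u) ≤ 1 < A`; so `v c₁ > 1 = v u` and `v(c₁ + u) = v c₁`
    by_cases hc : v c₁ ≤ 1
    · exfalso
      have : v (c₁ + u) ≤ 1 := Valuation.map_add_le v hc hu.le
      rw [he₁] at this
      exact not_lt_of_ge this hA
    · rw [not_le] at hc
      have hlt : v u < v c₁ := by rw [hu]; exact hc
      rw [← he₁, Valuation.map_add_eq_of_lt_left v hlt]
  · rw [← he₃, Valuation.map_mul, hu, mul_one]

/-- **The hyperbolicity inequality from the cubic pattern**: under the hypotheses of `valuation_quadratic_of_cubic_pattern` with moreover `B ≤ A` (the shell pattern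
has `v(e₃) = |z|³ ≤ |z|·q^{m} = v(e₁)`), `v(c₂) < v(c₁)²` — the hypothesis of ★ HYP `exists_mem_unitaryGroup_eigenframe_of_valued_det_lt` (`c₁ = tr h₂`, `c₂ = det h₂`).
[cite: Rogawski1990, §3.6 p. 31; §12.7 p. 195] -/
theorem valued_lt_sq_of_cubic_pattern {c₁ c₂ u : R} {A B : Γ₀} (hu : v u = 1) (he₁ : v (c₁ + u) = A) (hA : 1 < A) (he₃ : v (c₂ * u) = B)
    (hBA : B ≤ A) : v c₂ < v c₁ ^ 2 := by
  obtain ⟨h1, h2⟩ := valuation_quadratic_of_cubic_pattern v hu he₁ hA he₃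
  rw [h1, h2, pow_two]
  have hA0 : A ≠ 0 := ne_of_gt (lt_trans zero_lt_one hA)
  calc B ≤ A := hBA
    _ = A * 1 := (mul_one A).symm
    _ < A * A := mul_lt_mul_of_pos_left hA (zero_lt_iff.2 hA0)

/-! ## §3 The coefficient dictionary of a `2 ⊕ 1` block matrix -/

/-- **`charpoly (h₂ ⊕ (u)) = charpoly(h₂) · (X − u)`, coefficientwise**: for the block-diagonal matrix `fromBlocks h₂ 0 0 (u·1₁)` (the image of `(h₂, u) ∈ U(Φ₂) × U(Φ₁)`
in `GL₃` up to the tree's reindexing), with `c₁ = tr h₂`, `c₂ = det h₂`: the sum of the three coefficient identities `e₁ = c₁ + u`, `e₂ = c₂ + c₁u`, `e₃ = c₂u` in the form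
`charpoly = X³ − (c₁ + u)X² + (c₂ + c₁u)X − c₂u`. [cite: Rogawski1990, §4.3 p. 42] -/
theorem charpoly_fromBlocks_two_one (h₂ : Matrix (Fin 2) (Fin 2) R) (u : R) :
    (Matrix.fromBlocks h₂ 0 0 (Matrix.diagonal fun _ : Fin 1 => u)).charpoly =
      X ^ 3 - C (h₂.trace + u) * X ^ 2 + C (h₂.det + h₂.trace * u) * X - C (h₂.det * u) := by
  nontriviality R
  rw [Matrix.charpoly_fromBlocks_zero₁₂, Matrix.charpoly_fin_two, Matrix.charpoly_diagonal, Fin.prod_univ_one]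
  simp only [map_add, map_mul]
  ring

/-- The three coefficients of `charpoly (h₂ ⊕ (u))` read off `charpoly_fromBlocks_two_one`. [cite: Rogawski1990, §4.3 p. 42] -/
theorem charpoly_fromBlocks_two_one_coeff (h₂ : Matrix (Fin 2) (Fin 2) R) (u : R) :
    (Matrix.fromBlocks h₂ 0 0 (Matrix.diagonal fun _ : Fin 1 => u)).charpoly.coeff 2 = -(h₂.trace + u) ∧
      (Matrix.fromBlocks h₂ 0 0 (Matrix.diagonal fun _ : Fin 1 => u)).charpoly.coeff 1 = h₂.det + h₂.trace * u ∧
      (Matrix.fromBlocks h₂ 0 0 (Matrix.diagonal fun _ : Fin 1 => u)).charpoly.coeff 0 = -(h₂.det * u) := by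
  rw [charpoly_fromBlocks_two_one]
  simp only [coeff_sub, coeff_add, coeff_C_mul, coeff_X_pow, coeff_X, coeff_C]
  norm_num

/-- **OFF-STRATUM TEST, cubic form**: if `charpoly (h₂ ⊕ (u))` has `v(coeff₂) = A`, `v(coeff₀) = B` with `1 < A`, `B ≤ A`, and `v(u) = 1`, then
`v(det h₂) < v(tr h₂)²` — the block `h₂` satisfies the hypothesis of ★ HYP (so `γ_H = (h₂, u)` is `H`-conjugate into the diagonal torus: ON the Levi stratum).
[cite: Rogawski1990, §4.3 p. 42; §3.6 p. 31; §12.7 p. 195] -/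
theorem valued_det_lt_trace_sq_of_charpoly_fromBlocks_pattern (h₂ : Matrix (Fin 2) (Fin 2) R) (u : R) {A B : Γ₀} (hu : v u = 1)
    (h2 : v ((Matrix.fromBlocks h₂ 0 0 (Matrix.diagonal fun _ : Fin 1 => u)).charpoly.coeff 2) = A)
    (h0 : v ((Matrix.fromBlocks h₂ 0 0 (Matrix.diagonal fun _ : Fin 1 => u)).charpoly.coeff 0) = B)
    (hA : 1 < A) (hBA : B ≤ A) : v h₂.det < v h₂.trace ^ 2 := by
  obtain ⟨hc2, -, hc0⟩ := charpoly_fromBlocks_two_one_coeff h₂ u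
  rw [hc2, Valuation.map_neg] at h2
  rw [hc0, Valuation.map_neg] at h0
  exact valued_lt_sq_of_cubic_pattern v hu h2 hA h0 hBA

end Ring

end Summit.HodgeConjecture.HodgeConjecture.Cruxes.H413.F0P3cStCharTSOffStratumVal
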